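import Mathlib
import Literature.Computability.MetaComplexity.ChenJinSanthanamWilliams2022.QueryRefuterMagnification
import HarnessLib

/-!
# The coin problem `GapMAJ_{n,ε}` against DETERMINISTIC query algorithms: `D(GapMAJ_{n,1/e}) ≥
# (1 − 2/e)·n − 1` by a balancing adversary, tight up to one query (census row R37, K side,
# deterministic sub-model)

Topic `Literature/Computability/MetaComplexity`, directory `ChenJinSanthanamWilliams2022/`
(bib key `ChenEtAl2022`).  `QueryRefuterMagnification.lean` types Chen–Jin–Santhanam–Williams'
Thm. 1.6 (census row R37): uniform-`AC⁰` / `NC¹` refuters for the coin problem `GapMAJ_{n,ε}`,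
`ε = 1/e(n)`, against bounded-gap RANDOMIZED query algorithms using `o(1/ε²)` queries magnify to
`P ≠ NP` / `P ≠ PSPACE`.  The printed KNOWN side (p. 6 L1: *"every randomized query algorithm needs
`Θ(1/ε²)` queries to solve `GapMAJ_{n,ε}` with constant success probability"*) is not typed there
(rendering note (iv)).  This file proves, in the SAME typed vocabulary (`Complexity.DecisionTree`,
`gapMajDomain`, `gapMajAnswer`, `RandQueryAlg.FailsOn`), the exact deterministic query complexity
of the coin problem — the known column of R37 restricted to the DETERMINISTIC sub-model (Dirac
families `fun n ↦ PMF.pure (T n)` of the row's `PMF (DecisionTree n)`):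

* LOWER BOUND (`e_mul_le_of_computesOn`, `le_detQueryComplexityOn_gapMaj`): every decision tree
  computing `GapMAJ_{n,1/e}` on its promise has `e·(depth + 1) + 2n ≥ e·n`, i.e.
  `depth ≥ (1 − 2ε)·n − 1`.  Device: a BALANCING ADVERSARY
  (`DecisionTree.exists_balanced_extension`, generic): answer every fresh query with the value used
  less often so far; after `q` queries at most
  `⌈q/2⌉` ones and `⌊q/2⌋` zeros are committed and every input consistent with them reaches the same
  leaf — completing with zeros gives a NO instance (`p ≤ ⌈q/2⌉/n < 1/2 − ε`), completing with ones a
  YES instance, so the tree errs on one of the two (`exists_mem_gapMajDomain_eval_ne`).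
* UPPER BOUND (`exists_computesOn_depth_le`, `detQueryComplexityOn_gapMaj_le`): reading ANY `m`
  coordinates with `e·m + 2n ≥ e·n` (`m ≥ (1 − 2ε)·n`) and answering `[e·n ≤ 2e·a + 2n]`, `a` the
  number of ones seen, decides the promise problem; so `D(GapMAJ_{n,1/e}) ∈ {m₀ − 1, m₀}` for the
  least such `m₀` (`Θ(n)` for every fixed `ε < 1/2`, versus the printed randomized `Θ(1/ε²)`).
* ROW VOCABULARY (`exists_failsOn_pure`, `eventually_exists_failsOn_pure`,
  `eventually_exists_failsOn_of_mem`): a deterministic member of the refuted class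
  `SubquadraticQueryAlgs e` with `q(n)` queries FAILS on some promise input at every length with
  `e(n)·(q(n)+1) + 2n < e(n)·n`; in the row's live regime `ε ≳ n^{-1/2}` (`e² = O(n)`, where
  `q = o(e²)` forces `q = o(n)`) this holds at all large lengths.  The counterexample is explicit
  (computable from the tree by one root-to-leaf walk) but depends on the algorithm; nothing here is
  claimed about UNIFORM printability (the row's residual) or about randomized algorithms (the row's
  printed K, `Θ(1/ε²)`, stays untyped).

All statements are fully proved here (no definition, no named fact); none is printed verbatim in
[ChenEtAl2022], whose known column is the RANDOMIZED bound.  Sources of the METHOD: the adversary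
argument for deterministic decision trees [Jukna 2012 (BFC), §14.1 pp. 405–406; Lemma 14.19 p. 418:
every non-constant symmetric function is evasive — the adversary answers so as to keep both counts
alive, which is the balancing strategy used here on the promise version of `MAJ`]; the model `D(f)`
and the trivial upper bound "query the variables in turn" [Buhrman–de Wolf 2002, §3.1, TCS 288
p. 24 L44 – p. 25 L5].  Source of the ROW: [ChenEtAl2022, §1.2.2 p. 5 L31–33 (GapMAJ_{n,ε}), p. 6 L1
(*"every randomized query algorithm needs Θ(1/ε²) queries"*), Thm. 1.6]; the randomized bound in
sampler language is [Goldreich 2011, *A sample of samplers*, Thm. 2.1 p. 5 (= Canetti–Even–Goldreich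
1995): sample complexity `≥ min(2^{(n−4)/2}, ln(1/O(δ))/(4ε²))`], not typed here.

References: [cite: ChenEtAl2022, §1.2.2 (GapMAJ_{n,ε}, p. 5 L31–33; p. 6 L1 known column),
Thm. 1.6];
[cite: JuknaBFC2012, §14.1 (adversary arguments, pp. 405–406); Lemma 14.19 (p. 418)];
[cite: Wolf2002, §3.1 (deterministic decision trees, D(f); TCS 288 (2002) p. 24 L44 – p. 25 L5)];
[cite: Goldreich2011Samplers, Thm. 2.1 (p. 5, sample-complexity lower bound Ω(log(1/δ)/ε²))].
-/

open Finset Filter Asymptotics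

namespace Literature.Computability.Complexity.DecisionTree

variable {n : ℕ}

/-- **Balancing adversary (generic).** Given a partial assignment (`O` = coordinates set to `1`,
`Z` = coordinates set to `0`, disjoint) and budgets `u`, `v` with `depth T ≤ u + v`, `|u − v| ≤ 1`,
the adversary walks `T` answering committed coordinates as committed and each fresh coordinate with
the value whose budget is larger; it ends at a leaf `b` having committed at most `u` new ones and
`v` new zeros, and EVERY input consistent with the final assignment evaluates to `b`.
[cite: JuknaBFC2012, §14.1 (adversary arguments, pp. 405–406) and Lemma 14.19 (p. 418)] -/
theorem exists_balanced_extension (T : DecisionTree n) :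
    ∀ (O Z : Finset (Fin n)) (u v : ℕ), Disjoint O Z → T.depth ≤ u + v → u ≤ v + 1 → v ≤ u + 1 →
      ∃ O' Z' : Finset (Fin n), O ⊆ O' ∧ Z ⊆ Z' ∧ Disjoint O' Z' ∧
        O'.card ≤ O.card + u ∧ Z'.card ≤ Z.card + v ∧
        ∃ b : Bool, ∀ y : Fin n → Bool, (∀ i ∈ O', y i = true) → (∀ i ∈ Z', y i = false) →
          T.eval y = b := by
  induction T with
  | leaf b =>
    intro O Z u v hOZ _ _ _
    exact ⟨O, Z, Subset.rfl, Subset.rfl, hOZ, by omega, by omega, b, fun y _ _ => rfl⟩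
  | query i t₀ t₁ ih₀ ih₁ =>
    intro O Z u v hOZ hd hu hv
    rw [depth_query] at hd
    by_cases hiO : i ∈ O
    · -- the answer at `i` is already committed to `1`
      obtain ⟨O', Z', hO, hZ, hdj, hcO, hcZ, b, hb⟩ := ih₁ O Z u v hOZ (by omega) hu hv
      refine ⟨O', Z', hO, hZ, hdj, hcO, hcZ, b, fun y hyO hyZ => ?_⟩
      rw [eval_query, if_pos (hyO i (hO hiO))]
      exact hb y hyO hyZ
    by_cases hiZ : i ∈ Z
    · -- the answer at `i` is already committed to `0`
      obtain ⟨O', Z', hO, hZ, hdj, hcO, hcZ, b, hb⟩ := ih₀ O Z u v hOZ (by omega) hu hv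
      refine ⟨O', Z', hO, hZ, hdj, hcO, hcZ, b, fun y hyO hyZ => ?_⟩
      have hyi : y i = false := hyZ i (hZ hiZ)
      rw [eval_query, if_neg (by rw [hyi]; exact Bool.false_ne_true)]
      exact hb y hyO hyZ
    -- a fresh coordinate: answer with the value whose budget is larger
    by_cases huv : v ≤ u
    · have hdj' : Disjoint (insert i O) Z := by
        rw [Finset.disjoint_insert_left]; exact ⟨hiZ, hOZ⟩
      obtain ⟨O', Z', hO, hZ, hdj, hcO, hcZ, b, hb⟩ :=
        ih₁ (insert i O) Z (u - 1) v hdj' (by omega) (by omega) (by omega)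
      have hcard : (insert i O).card = O.card + 1 := card_insert_of_notMem hiO
      refine ⟨O', Z', (subset_insert i O).trans hO, hZ, hdj, by omega, hcZ, b,
        fun y hyO hyZ => ?_⟩
      rw [eval_query, if_pos (hyO i (hO (mem_insert_self i O)))]
      exact hb y hyO hyZ
    · have hdj' : Disjoint O (insert i Z) := by
        rw [Finset.disjoint_insert_right]; exact ⟨hiO, hOZ⟩
      obtain ⟨O', Z', hO, hZ, hdj, hcO, hcZ, b, hb⟩ :=
        ih₀ O (insert i Z) u (v - 1) hdj' (by omega) (by omega) (by omega)
      have hcard : (insert i Z).card = Z.card + 1 := card_insert_of_notMem hiZ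
      refine ⟨O', Z', hO, (subset_insert i Z).trans hZ, hdj, hcO, by omega, b,
        fun y hyO hyZ => ?_⟩
      have hyi : y i = false := hyZ i (hZ (mem_insert_self i Z))
      rw [eval_query, if_neg (by rw [hyi]; exact Bool.false_ne_true)]
      exact hb y hyO hyZ

/-- **The adversary pair.** For every decision tree `T` of depth `q` there are disjoint sets `O`,
`Z` of coordinates with `2|O| ≤ q + 1`, `2|Z| ≤ q`, such that the indicator of `O` and the
co-indicator of `Z` (ones outside `Z`) reach the same leaf.
[cite: JuknaBFC2012, §14.1 (adversary arguments, pp. 405–406) and Lemma 14.19 (p. 418)] -/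
theorem exists_pair_eval_eq (T : DecisionTree n) :
    ∃ O Z : Finset (Fin n), Disjoint O Z ∧ 2 * O.card ≤ T.depth + 1 ∧ 2 * Z.card ≤ T.depth ∧
      T.eval (fun i => decide (i ∈ O)) = T.eval (fun i => decide (i ∉ Z)) := by
  obtain ⟨O', Z', -, -, hdj, hcO, hcZ, b, hb⟩ :=
    T.exists_balanced_extension ∅ ∅ ((T.depth + 1) / 2) (T.depth / 2)
      (disjoint_empty_left _) (by omega) (by omega) (by omega)
  refine ⟨O', Z', hdj, ?_, ?_, ?_⟩
  · rw [card_empty] at hcO; omega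
  · rw [card_empty] at hcZ; omega
  · rw [hb _ (fun i hi => by simp [hi]) (fun i hi => by simp [Finset.disjoint_right.mp hdj hi]),
      hb _ (fun i hi => by simp [Finset.disjoint_left.mp hdj hi]) (fun i hi => by simp [hi])]

/-- **Counting trees (upper-bound device).** For every set `S` of coordinates and every rule
`g : ℕ → Bool` there is a decision tree of depth `≤ |S|` outputting `g(a)`, `a` = the number of
ones of the input inside `S` (query the coordinates of `S` in turn, keep the count).
[cite: Wolf2002, §3.1 (D(f) ≤ n: query the variables in turn; TCS 288 p. 25 L1–5)] -/
theorem exists_depth_le_eval_eq_count (S : Finset (Fin n)) :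
    ∀ g : ℕ → Bool, ∃ T : DecisionTree n, T.depth ≤ S.card ∧
      ∀ x : Fin n → Bool, T.eval x = g (S.filter fun i => x i = true).card := by
  induction S using Finset.induction_on with
  | empty => intro g; exact ⟨leaf (g 0), by simp, fun x => by simp⟩
  | insert i S hi ih =>
    intro g
    obtain ⟨T₀, hd₀, he₀⟩ := ih g
    obtain ⟨T₁, hd₁, he₁⟩ := ih fun k => g (k + 1)
    refine ⟨query i T₀ T₁, ?_, fun x => ?_⟩
    · rw [depth_query, card_insert_of_notMem hi]; omega
    · rw [eval_query, filter_insert]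
      cases hxi : x i
      · rw [if_neg (by simp), he₀, if_neg (by simp)]
      · rw [if_pos rfl, he₁, if_pos rfl, card_insert_of_notMem (by simp [hi])]

end Literature.Computability.Complexity.DecisionTree

namespace Literature.Computability.MetaComplexity.ChenJinSanthanamWilliams2022

open Literature.Computability.Complexity Literature.Computability.Complexity.DecisionTree

variable {n : ℕ}

/-! ### Weights of the adversary's two completions -/

/-- The indicator of `O` has Hamming weight `|O|` (helper). [folklore] -/
private theorem numOnes_indicator (O : Finset (Fin n)) :
    GateFn.numOnes (fun i : Fin n => decide (i ∈ O)) = O.card := by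
  unfold GateFn.numOnes
  congr 1; ext i; simp

/-- The co-indicator of `Z` (ones exactly outside `Z`) has Hamming weight `n − |Z|` (helper).
[folklore] -/
private theorem numOnes_coindicator_add (Z : Finset (Fin n)) :
    GateFn.numOnes (fun i : Fin n => decide (i ∉ Z)) + Z.card = n := by
  unfold GateFn.numOnes
  have h : (univ.filter fun i : Fin n => decide (i ∉ Z) = true) = Zᶜ := by ext i; simp
  rw [h, card_compl, Fintype.card_fin]
  have := Z.card_le_univ
  rw [Fintype.card_fin] at this
  omega

/-! ### Lower bound: the balancing adversary -/

/-- **Adversary lower bound for the coin problem (deterministic).** A decision tree of depth `q`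
with `e·(q+1) + 2n < e·n` — i.e. `q + 1 < (1 − 2ε)n`, `ε = 1/e` — errs on some promise input of
`GapMAJ_{n,ε}`: the adversary's zero-completion has weight `≤ ⌈q/2⌉ < (1/2 − ε)n` (a NO instance),
its one-completion has weight `≥ n − ⌊q/2⌋ > (1/2 + ε)n` (a YES instance), and both reach the same
leaf.
[cite: ChenEtAl2022, §1.2.2 (GapMAJ p. 5 L31–33; known column p. 6 L1, deterministic sub-model); JuknaBFC2012 §14.1] -/
theorem exists_mem_gapMajDomain_eval_ne {e : ℕ} (T : DecisionTree n)
    (h : e * (T.depth + 1) + 2 * n < e * n) :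
    ∃ x ∈ gapMajDomain n e, T.eval x ≠ gapMajAnswer e x := by
  obtain ⟨O, Z, -, hO, hZ, heq⟩ := T.exists_pair_eval_eq
  have hno : GapMajNo e (fun i : Fin n => decide (i ∈ O)) := by
    unfold GapMajNo
    rw [numOnes_indicator]
    have h1 : e * (2 * O.card) ≤ e * (T.depth + 1) := Nat.mul_le_mul (le_refl e) hO
    linarith
  have hyes : GapMajYes e (fun i : Fin n => decide (i ∉ Z)) := by
    unfold GapMajYes
    have hw := numOnes_coindicator_add Z
    set w := GateFn.numOnes (fun i : Fin n => decide (i ∉ Z)) with hw_def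
    have h1 : e * (2 * Z.card) ≤ e * T.depth := Nat.mul_le_mul (le_refl e) hZ
    have h2 : e * w + e * Z.card = e * n := by rw [← mul_add, hw]
    linarith
  by_contra hall
  push Not at hall
  have h0 := hall _ (Or.inr hno)
  have h1 := hall _ (Or.inl hyes)
  rw [gapMajAnswer, decide_eq_false (not_gapMajYes_of_gapMajNo hno)] at h0
  rw [gapMajAnswer, decide_eq_true hyes] at h1
  rw [h0, h1] at heq
  exact Bool.false_ne_true heq

/-- **Lower bound, `ComputesOn` form**: a tree computing `GapMAJ_{n,1/e}` on the promise has
`e·n ≤ e·(depth + 1) + 2n`, i.e. `depth ≥ (1 − 2/e)·n − 1`.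
[cite: ChenEtAl2022, §1.2.2 (GapMAJ p. 5 L31–33; known column p. 6 L1, deterministic sub-model); JuknaBFC2012 §14.1] -/
theorem e_mul_le_of_computesOn {e : ℕ} {T : DecisionTree n}
    (hT : T.ComputesOn (gapMajDomain n e) (gapMajAnswer e)) :
    e * n ≤ e * (T.depth + 1) + 2 * n := by
  by_contra h
  push Not at h
  obtain ⟨x, hx, hne⟩ := exists_mem_gapMajDomain_eval_ne T h
  exact hne (hT x hx)

/-- **`D(GapMAJ_{n,1/e}) ≥ (1 − 2/e)·n − 1`**, stated with the tree's deterministic query complexity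
of partial functions `detQueryComplexityOn`: `e·n ≤ e·(D + 1) + 2n`.
[cite: ChenEtAl2022, §1.2.2 (GapMAJ p. 5 L31–33; known column p. 6 L1, deterministic sub-model); JuknaBFC2012 §14.1] -/
theorem le_detQueryComplexityOn_gapMaj (n e : ℕ) :
    e * n ≤
      e * (detQueryComplexityOn (gapMajDomain n e) (gapMajAnswer (n := n) e) + 1) + 2 * n := by
  have hne : {d | ∃ T : DecisionTree n, T.depth = d ∧
      T.ComputesOn (gapMajDomain n e) (gapMajAnswer (n := n) e)}.Nonempty := by
    obtain ⟨T, hT, -⟩ := DecisionTree.exists_computes_depth_le (gapMajAnswer (n := n) e)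
    exact ⟨T.depth, T, rfl, hT.computesOn _⟩
  obtain ⟨T, hTd, hT⟩ := Nat.sInf_mem hne
  have := e_mul_le_of_computesOn hT
  rw [hTd] at this
  exact this

/-! ### Upper bound: counting any `m ≥ (1 − 2ε)n` coordinates -/

/-- **Upper bound.** If `e·n ≤ e·|S| + 2n` then the counting tree over `S` with leaf rule
`a ↦ [e·n ≤ 2e·a + 2n]` computes `GapMAJ_{n,1/e}` on the promise (depth `≤ |S|`): on a NO instance
`2e·a + 2n ≤ 2e·w + 2n < e·n`; on a YES instance `w ≤ a + (n − |S|)` and `e·(n − |S|) ≤ 2n` give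
`e·n + 2n < 2e·w ≤ 2e·a + 4n`.
[cite: ChenEtAl2022, §1.2.2 (GapMAJ p. 5 L31–33; known column p. 6 L1, deterministic sub-model); Wolf2002 §3.1] -/
theorem exists_computesOn_depth_le_card {e : ℕ} (S : Finset (Fin n))
    (hS : e * n ≤ e * S.card + 2 * n) :
    ∃ T : DecisionTree n, T.depth ≤ S.card ∧
      T.ComputesOn (gapMajDomain n e) (gapMajAnswer e) := by
  obtain ⟨T, hd, he⟩ :=
    DecisionTree.exists_depth_le_eval_eq_count S fun a => decide (e * n ≤ 2 * e * a + 2 * n)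
  refine ⟨T, hd, fun x hx => ?_⟩
  rw [he x, gapMajAnswer]
  set a := (S.filter fun i => x i = true).card with ha_def
  set w := GateFn.numOnes x with hw_def
  -- `a ≤ w ≤ a + |Sᶜ|`
  have haw : a ≤ w := by
    rw [ha_def, hw_def, GateFn.numOnes]
    exact card_le_card (filter_subset_filter _ (subset_univ S))
  have hwa : w ≤ a + Sᶜ.card := by
    rw [ha_def, hw_def, GateFn.numOnes]
    calc (univ.filter fun i => x i = true).card
        ≤ ((S.filter fun i => x i = true) ∪ Sᶜ).card := by
          refine card_le_card fun i hi => ?_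
          rw [mem_filter] at hi
          by_cases hiS : i ∈ S
          · exact mem_union_left _ (mem_filter.mpr ⟨hiS, hi.2⟩)
          · exact mem_union_right _ (mem_compl.mpr hiS)
      _ ≤ (S.filter fun i => x i = true).card + Sᶜ.card := card_union_le _ _
  have hc : Sᶜ.card + S.card = n := by
    rw [card_compl, Fintype.card_fin]
    have := S.card_le_univ
    rw [Fintype.card_fin] at this
    omega
  rcases hx with hyes | hno
  · -- YES instance: the rule fires
    rw [decide_eq_true hyes]
    refine decide_eq_true ?_
    unfold GapMajYes at hyes
    have h1 : e * w ≤ e * (a + Sᶜ.card) := Nat.mul_le_mul (le_refl e) hwa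
    have h2 : e * Sᶜ.card + e * S.card = e * n := by rw [← mul_add, hc]
    linarith
  · -- NO instance: the rule does not fire
    rw [decide_eq_false (not_gapMajYes_of_gapMajNo hno)]
    refine decide_eq_false ?_
    unfold GapMajNo at hno
    have h1 : e * a ≤ e * w := Nat.mul_le_mul (le_refl e) haw
    linarith

/-- **Upper bound, depth form**: for every `m` with `e·n ≤ e·m + 2n` there is a tree of depth
`≤ m` computing `GapMAJ_{n,1/e}` on the promise (read `min m n` coordinates).
[cite: ChenEtAl2022, §1.2.2 (GapMAJ p. 5 L31–33; known column p. 6 L1, deterministic sub-model); Wolf2002 §3.1] -/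
theorem exists_computesOn_depth_le {e m : ℕ} (hm : e * n ≤ e * m + 2 * n) :
    ∃ T : DecisionTree n, T.depth ≤ m ∧ T.ComputesOn (gapMajDomain n e) (gapMajAnswer e) := by
  have hmin : min m n ≤ (univ : Finset (Fin n)).card := by
    rw [card_univ, Fintype.card_fin]; exact min_le_right m n
  obtain ⟨S, -, hS⟩ := exists_subset_card_eq hmin
  have hS' : e * n ≤ e * S.card + 2 * n := by
    rw [hS]
    rcases le_total m n with hmn | hnm
    · rw [min_eq_left hmn]; exact hm
    · rw [min_eq_right hnm]; omega
  obtain ⟨T, hd, hT⟩ := exists_computesOn_depth_le_card S hS'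
  exact ⟨T, hd.trans (hS ▸ min_le_left m n), hT⟩

/-- **`D(GapMAJ_{n,1/e}) ≤ m` for every `m ≥ (1 − 2/e)·n`** (`e·n ≤ e·m + 2n`); with
`le_detQueryComplexityOn_gapMaj` the deterministic query complexity of the coin problem is pinned to
`{m₀ − 1, m₀}`, `m₀` the least such `m`.
[cite: ChenEtAl2022, §1.2.2 (GapMAJ p. 5 L31–33; known column p. 6 L1, deterministic sub-model); Wolf2002 §3.1] -/
theorem detQueryComplexityOn_gapMaj_le {e m : ℕ} (hm : e * n ≤ e * m + 2 * n) :
    detQueryComplexityOn (gapMajDomain n e) (gapMajAnswer (n := n) e) ≤ m := by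
  obtain ⟨T, hd, hT⟩ := exists_computesOn_depth_le (n := n) hm
  exact (detQueryComplexityOn_le_depth T hT).trans hd

/-! ### Row vocabulary: deterministic members of the refuted class are refuted -/

/-- **A deterministic query algorithm with few queries FAILS on a promise input** (row R37's
`RandQueryAlg.FailsOn`, Dirac family `fun n ↦ PMF.pure (T n)`): at every length `n` with
`e(n)·(depth (T n) + 1) + 2n < e(n)·n` some promise input of `GapMAJ_{n,1/e(n)}` receives the right
answer with probability `0 < 2/3`.
[cite: ChenEtAl2022, §1.2.2 (GapMAJ p. 5 L31–33; known column p. 6 L1, deterministic sub-model); JuknaBFC2012 §14.1] -/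
theorem exists_failsOn_pure (T : (n : ℕ) → DecisionTree n) {e : ℕ → ℕ} {n : ℕ}
    (h : e n * ((T n).depth + 1) + 2 * n < e n * n) :
    ∃ x : Fin n → Bool, RandQueryAlg.FailsOn (fun n => PMF.pure (T n)) e x := by
  obtain ⟨x, hx, hne⟩ := exists_mem_gapMajDomain_eval_ne (T n) h
  refine ⟨x, hx, ?_⟩
  rw [outputPr_pure, if_neg hne]
  norm_num

/-- **Eventual form**: a deterministic algorithm using `≤ q(n)` queries fails on some promise input
at every large length, provided eventually `e(n)·(q(n)+1) + 2n < e(n)·n` (`q + 1 < (1 − 2ε)n`).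
[cite: ChenEtAl2022, §1.2.2 (GapMAJ p. 5 L31–33; known column p. 6 L1, deterministic sub-model); JuknaBFC2012 §14.1] -/
theorem eventually_exists_failsOn_pure (T : (n : ℕ) → DecisionTree n) {e q : ℕ → ℕ}
    (hq : RandQueryAlg.QueriesLe (fun n => PMF.pure (T n)) q)
    (h : ∀ᶠ n in atTop, e n * (q n + 1) + 2 * n < e n * n) :
    ∀ᶠ n in atTop, ∃ x : Fin n → Bool, RandQueryAlg.FailsOn (fun n => PMF.pure (T n)) e x := by
  refine h.mono fun n hn => exists_failsOn_pure T ?_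
  have hd : (T n).depth ≤ q n := hq n (T n) (by simp)
  have : e n * ((T n).depth + 1) ≤ e n * (q n + 1) := Nat.mul_le_mul (le_refl _) (by omega)
  omega

/-- `q = o(n)` and `ε ≤ 1/3` eventually give the adversary's hypothesis `e·(q+1) + 2n < e·n`
eventually (bookkeeping for the row's regime `q = o(1/ε²)`, `ε ≳ n^{-1/2}`).
[cite: ChenEtAl2022, §1.2.2 (GapMAJ p. 5 L31–33; known column p. 6 L1, deterministic sub-model); JuknaBFC2012 §14.1] -/
theorem eventually_adversary_hypothesis {e q : ℕ → ℕ}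
    (hq : (fun n => (q n : ℝ)) =o[atTop] fun n => (n : ℝ)) (he : ∀ᶠ n in atTop, 3 ≤ e n) :
    ∀ᶠ n in atTop, e n * (q n + 1) + 2 * n < e n * n := by
  have hq' := hq.def (by norm_num : (0 : ℝ) < 1 / 4)
  filter_upwards [hq', he, eventually_ge_atTop 13] with n hqn hen hn
  rw [Real.norm_natCast, Real.norm_natCast] at hqn
  have hen' : (3 : ℝ) ≤ (e n : ℝ) := by exact_mod_cast hen
  have hn' : (13 : ℝ) ≤ (n : ℝ) := by exact_mod_cast hn
  have key : (e n : ℝ) * ((q n : ℝ) + 1) + 2 * (n : ℝ) < (e n : ℝ) * (n : ℝ) := by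
    have h1 : (e n : ℝ) * (q n : ℝ) ≤ (e n : ℝ) * (1 / 4 * (n : ℝ)) :=
      mul_le_mul_of_nonneg_left hqn (by linarith)
    nlinarith [mul_nonneg (sub_nonneg.2 hen') (sub_nonneg.2 hn')]
  exact_mod_cast key

/-- **The deterministic sub-model of row R37 is refuted in the live regime.** If a DETERMINISTIC
family belongs to the refuted class `SubquadraticQueryAlgs e` (`q = o(e²)` queries), `e(n)² =
O(n)` (the row's live regime `ε ≳ n^{-1/2}`, cf. `not_hypothesis_of_isLittleO`) and `ε ≤ 1/3`
eventually, then it fails on some promise input of `GapMAJ_{n,1/e(n)}` at every large length `n`.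
(The counterexample depends on the algorithm; uniform printability — the row's residual — is not
addressed, and the printed randomized `Θ(1/ε²)` bound is not typed.)
[cite: ChenEtAl2022, §1.2.2 (GapMAJ p. 5 L31–33; known column p. 6 L1, deterministic sub-model); JuknaBFC2012 §14.1] -/
theorem eventually_exists_failsOn_of_mem (T : (n : ℕ) → DecisionTree n) {e : ℕ → ℕ}
    (hA : (fun n => PMF.pure (T n)) ∈ SubquadraticQueryAlgs e)
    (he2 : (fun n => ((e n : ℝ)) ^ 2) =O[atTop] fun n => (n : ℝ))
    (he3 : ∀ᶠ n in atTop, 3 ≤ e n) :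
    ∀ᶠ n in atTop, ∃ x : Fin n → Bool, RandQueryAlg.FailsOn (fun n => PMF.pure (T n)) e x := by
  obtain ⟨-, q, hq, hqo⟩ := hA
  exact eventually_exists_failsOn_pure T hq
    (eventually_adversary_hypothesis (hqo.trans_isBigO he2) he3)

end Literature.Computability.MetaComplexity.ChenJinSanthanamWilliams2022
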